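import Mathlib
import HarnessLib
import Literature.Analysis.FluidPDE.AxisymmetricEuler
import Literature.Analysis.FluidPDE.AxisymHouLiVariables
import Literature.Analysis.FluidPDE.SwirlTransportProofs
import Literature.Analysis.FluidPDE.NSBoundedMildOseen
import Literature.Analysis.FluidPDE.NSBoundedMildSmoothing
import Literature.Analysis.FluidPDE.VorticityCalculus
import Literature.Analysis.UnboundedOperators.HeatKernel
import Summits.NavierStokesRegularity.NavierStokesRegularity.Theorems.ThreadingFluxPoloidalLiouvillePrecessionFastW1

/-!
# Route `UnthreadedRigidityDoor`, item `UnthreadedRigidity` (W2, stmt-NavierStokesRegularity-27585) — crux idea «precession-gap» (ns-idea-15,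
# `Cruxes/PoloidalLiouville/PrecessionSketch.lean` v2; V16-P5 form), RUNG G `FastPrecessionUnthreadedRigidity` FROM D `ShortPeriodCollapse` AND THE
# REGULARITY SOURCE P3 `BoundedHonestMildSlicesC2` (sketch v3 d1159abe0cdc, V16-P5 PAID) — the priced chain `FastPrecessionChainW2` with g2 discharged

Cell ns-regularity-ideate, seat ns-poloidal-K2-p2 g12 (hand for F/G per DIRECTOR-NS #264/#267/#270; `--supports` the W2 item).

`fastPrecessionUnthreadedRigidity_of_shortPeriodCollapse (hD) (hP3) : «G»`, with «G» the body of `Precession.FastPrecessionUnthreadedRigidity`, `hD` the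
body of `Precession.ShortPeriodCollapse` and `hP3` the body of `Precession.BoundedHonestMildSlicesC2` (sketch v3, crux-write d1159abe0cdc; ns-wall-crit-1
V16-P5: D consumes `C²`), all VERBATIM up to unfolding the sketch-local `IsOseenMildOn` / `IsRotatingWave`.  So this file proves exactly
`Precession.FastPrecessionChainW2` with its middle hypothesis g2 (`SteadyRotatingWaveAxisymmetric`) discharged.
CHAIN: `C := 2π/c₀`; `B ≤ 0` ⇒ `u ≡ 0` and any non-zero skew map works (the rotation generator `J`, tree `rotGenL`); `B > 0` ⇒ `Ω ≠ 0`, period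
`P = 2π/|Ω|`, `P B² ≤ c₀`, `‖u‖ ≤ B`, slices measurable (continuity) ⇒ P3 gives `C²` ⇒ D gives STEADY ⇒ the profile `V = u 0 (· + x₀)` is axisymmetric
(g2, as in the F file) and `C¹`, so the infinitesimal axisymmetry `DV(y)[Jy] = J V(y)` (tree `IsAxisymmetric.fderiv_rotGen`) transported by the
translation `x ↦ x − x₀` is exactly G's conclusion with `A := J`.  The swirl lemma and KNSS are not needed for the W2 shape.

HONEST LABEL: CONDITIONAL rung — D and P3 carried as explicit hypotheses, not proved here; movement on 27585 = 0; W2 / `stub_shearedRigidity` untouched.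
WHAT THIS IS NOT: not a claim about Navier–Stokes regularity; items 1222 / 27585 OPEN.
-/

noncomputable section

-- the summit and its single sub-problem share the name (CONVENTIONS §1), as in every Theorems file
set_option linter.dupNamespace false

namespace Summit.NavierStokesRegularity.NavierStokesRegularity.Theorems.UnthreadedRigidityDoorUnthreadedRigidityPrecessionFastW2

open Set Function Filter Topology Metric MeasureTheory
open scoped RealInnerProductSpace InnerProductSpace
open Literature.Analysis Literature.Analysis.FluidPDE Literature.Analysis.UnboundedOperators
open Summit.NavierStokesRegularity.NavierStokesRegularity.Theorems.ThreadingFluxPoloidalLiouvillePrecessionFastW1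

/-- **RUNG G from D and P3.**  See the module docstring. -/
theorem fastPrecessionUnthreadedRigidity_of_shortPeriodCollapse
    (hD : ∃ c₀ : ℝ, 0 < c₀ ∧ ∀ (u : ℝ → EuclideanSpace ℝ (Fin 3) → EuclideanSpace ℝ (Fin 3)) (P B : ℝ), 0 < P →
      ContDiff ℝ 2 (uncurry u) → (∀ t, VectorCalculus.IsDivFree (u t)) → (∀ t x, ‖u t x‖ ≤ B) →
      (∀ s ∈ (univ : Set ℝ), ∀ t ∈ (univ : Set ℝ), s < t → ∀ x,
        u t x = heatExtension (u s) (t - s) x - oseenDuhamel 1 s u u t x) →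
      (∀ t x, u (t + P) x = u t x) → P * B ^ 2 ≤ c₀ → ∀ s t x, u s x = u t x)
    (hP3 : ∀ (u : ℝ → EuclideanSpace ℝ (Fin 3) → EuclideanSpace ℝ (Fin 3)) (B : ℝ), Continuous (uncurry u) →
      (∀ t, AEStronglyMeasurable (u t) volume) → (∀ t x, ‖u t x‖ ≤ B) →
      (∀ s ∈ (univ : Set ℝ), ∀ t ∈ (univ : Set ℝ), s < t → ∀ x,
        u t x = heatExtension (u s) (t - s) x - oseenDuhamel 1 s u u t x) →
      ContDiff ℝ 2 (uncurry u)) :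
    ∃ C : ℝ, 0 < C ∧ ∀ (u : ℝ → EuclideanSpace ℝ (Fin 3) → EuclideanSpace ℝ (Fin 3)) (x₀ : EuclideanSpace ℝ (Fin 3)) (Ω B : ℝ)
      (V : EuclideanSpace ℝ (Fin 3) → EuclideanSpace ℝ (Fin 3)),
      Continuous (uncurry u) → (∀ t, VectorCalculus.IsDivFree (u t)) →
      (∀ s ∈ (univ : Set ℝ), ∀ t ∈ (univ : Set ℝ), s < t → ∀ x,
        u t x = heatExtension (u s) (t - s) x - oseenDuhamel 1 s u u t x) →
      (∀ t x, u t x = rotZ (Ω * t) (V (rotZ (-(Ω * t)) (x - x₀)))) → (∀ x, ‖V x‖ ≤ B) → C * B ^ 2 ≤ |Ω| →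
      (∀ t x, inner ℝ (curl (u t) x) (x - x₀) = 0) →
      ∃ A : EuclideanSpace ℝ (Fin 3) →L[ℝ] EuclideanSpace ℝ (Fin 3), (∀ x, inner ℝ (A x) x = 0) ∧ A ≠ 0 ∧
        ∀ t x, fderiv ℝ (u t) x (A (x - x₀)) - A (u t x) = 0 := by
  obtain ⟨c₀, hc₀, hD⟩ := hD
  refine ⟨2 * Real.pi / c₀, by positivity, ?_⟩
  intro u x₀ Ω B V hcont hdiv hmild hrw hVB hfast _hunthr
  -- the skew map: the rotation generator `J`
  have hJskew : ∀ x : EuclideanSpace ℝ (Fin 3), inner ℝ (rotGenL x) x = 0 := fun x => by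
    rw [rotGenL_apply]; exact inner_rotGen_self x
  have hJne : (rotGenL : EuclideanSpace ℝ (Fin 3) →L[ℝ] EuclideanSpace ℝ (Fin 3)) ≠ 0 := by
    intro h
    have h1 := congrArg (fun L : EuclideanSpace ℝ (Fin 3) →L[ℝ] EuclideanSpace ℝ (Fin 3) => L (EuclideanSpace.single 0 1) 1) h
    simp [rotGenL_apply] at h1
  refine ⟨rotGenL, hJskew, hJne, ?_⟩
  -- the corner `B ≤ 0`: `u ≡ 0`
  by_cases hB : B ≤ 0
  · have hV0 : ∀ x, V x = 0 := fun x => norm_le_zero_iff.1 ((hVB x).trans hB)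
    have hu0 : ∀ t, u t = fun _ => (0 : EuclideanSpace ℝ (Fin 3)) := fun t => funext fun x => by rw [hrw, hV0, rotZ_apply_zero_vec]
    intro t x
    rw [hu0 t]
    have hJ0 : rotGen (0 : EuclideanSpace ℝ (Fin 3)) = 0 := by ext i; fin_cases i <;> simp [rotGen]
    simp [hJ0]
  push Not at hB
  -- `Ω ≠ 0`, the period and the short-period hypothesis
  have hΩabs : 0 < |Ω| := lt_of_lt_of_le (by positivity) hfast
  have hΩ : Ω ≠ 0 := abs_pos.1 hΩabs
  set P : ℝ := 2 * Real.pi / |Ω| with hP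
  have hPpos : 0 < P := by positivity
  have hPB : P * B ^ 2 ≤ c₀ := by
    rw [hP, div_mul_eq_mul_div, div_le_iff₀ hΩabs]
    have h := mul_le_mul_of_nonneg_left hfast hc₀.le
    rw [← mul_assoc, mul_div_cancel₀ _ hc₀.ne'] at h
    linarith
  have hper : ∀ t x, u (t + P) x = u t x := fun t x => rotatingWave_periodic hrw hΩ t x
  have hbdd : ∀ t x, ‖u t x‖ ≤ B := fun t x => by rw [hrw, norm_rotZ]; exact hVB _
  have hmeas : ∀ t, AEStronglyMeasurable (u t) volume := fun t =>
    (hcont.comp (continuous_const.prodMk continuous_id)).aestronglyMeasurable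
  -- P3: joint `C²`; D: steady
  have hC2 : ContDiff ℝ 2 (uncurry u) := hP3 u B hcont hmeas hbdd hmild
  have hsteady : ∀ s t x, u s x = u t x := hD u P B hPpos hC2 hdiv hbdd hmild hper hPB
  -- the profile and its axisymmetry
  have hV : ∀ y, V y = u 0 (y + x₀) := fun y => by rw [hrw]; simp [rotZ_zero]
  have hVfun : V = fun y => u 0 (y + x₀) := funext hV
  have hslice : ContDiff ℝ 2 (u 0) := hC2.comp (contDiff_const.prodMk contDiff_id)
  have hV1 : ContDiff ℝ 1 V := by
    rw [hVfun]; exact (hslice.comp (contDiff_id.add contDiff_const)).of_le one_le_two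
  have hVd : Differentiable ℝ V := hV1.differentiable one_ne_zero
  have hax : IsAxisymmetric V := by
    intro θ y
    have h1 := hsteady 0 (θ / Ω) (x₀ + rotZ θ y)
    rw [hrw, hrw] at h1
    simp only [mul_zero, neg_zero, rotZ_zero, add_sub_cancel_left, mul_div_cancel₀ _ hΩ, rotZ_neg_apply_rotZ] at h1
    exact h1
  -- every slice is the translated profile
  have hut : ∀ t, u t = fun x => V (x - x₀) := fun t => funext fun x => by
    rw [hsteady t 0, hV, sub_add_cancel]
  intro t x
  rw [hut t]
  have hcomp : fderiv ℝ (fun x => V (x - x₀)) x = fderiv ℝ V (x - x₀) := by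
    rw [show (fun x => V (x - x₀)) = fun x => V (x + -x₀) by funext y; rw [sub_eq_add_neg], fderiv_comp_add_right,
      ← sub_eq_add_neg]
  rw [hcomp, rotGenL_apply, rotGenL_apply, hax.fderiv_rotGen (hVd _), sub_self]

end Summit.NavierStokesRegularity.NavierStokesRegularity.Theorems.UnthreadedRigidityDoorUnthreadedRigidityPrecessionFastW2
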